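import Mathlib.NumberTheory.Zsqrtd.GaussianInt
import Mathlib.Data.ZMod.Basic
import Mathlib.Tactic.LinearCombination
import HarnessLib

/-!
# Road b02 (`VHCAbelianSchemesRoad`, D-0059) — lane R, «(D4) IN EVERY RANK» at the fibre `E³ × Ē³`, `E = ℂ∕ℤ[i]`: the SLOPE COMBINATORICS of the
# 32 signed kernel threefolds (the kernel-checked arithmetic behind evidence n°24 `D4-RANK0-KERNEL-GLUINGS-g87.md` on item stmt-HodgeConjecture-20707)

research route conditional on HC_CM; not a corollary; Q11.4-sentence-2 already refuted in dim ≥ 3.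

FACT-FREE ARITHMETIC ONLY (no definition, no cell ∕ carrier ∕ crux statement, `HC_CM` nowhere). Helper under the registered stub
`stub_residual_63_secantQuotientPinnedPrime` of skeleton v3.3 (crux `SemiregularSheafRepresentativesTwPrimeAtDiag`), director-hodge ruling R10.5 (3)(ii).

THE OBJECTS (evidence n°17 §3 (D4), n°22 §3, n°24 §0–§2). On `X = E³ × Ē³` the 32 rank-3 roots `A(a,b,c)` of the (D4) design have kernel abelian threefolds
`K_u = {z_{j+3} = u_j z_j}`, indexed by SLOPE VECTORS `u = (i^{a₀}, i^{a₁}, i^{a₂}) ∈ μ₄³` with `u₀u₁u₂ = ±1`, i.e. by exponent vectors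
`a ∈ (ℤ∕4)³` with `a₀ + a₁ + a₂ ∈ {0, 2}`; the SIGN of the root is `s(u) = u₀u₁u₂ = i^{a₀+a₁+a₂}` (`+1` iff the exponent sum is `0`, `−1` iff it is `2`), and the
signed sum of the kernel classes is `Σ_u s(u)[K_u] = 32·w_ℝ` (pure Weil). Two kernels `K_u`, `K_{u′}` meet (for suitable translates) along
`#{j : u_j = u′_j}`-dimensional subtori with `∏_{u_j ≠ u′_j} N(u_j − u′_j)` components, `N` the Gaussian norm, and `Ext•_X(𝒪_{K_u}, 𝒪_{K_{u′}})` lives in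
degrees `[3 − m, 3 + m]`, `m = #{j : u_j = u′_j}` (n°24 §2). The obstruction theorem of n°24 (§3 Theorem A: diagonal obstruction classes are immortal in every
distinct-support gluing) rests on exactly the following decidable facts, recorded here so that the memo's load-bearing arithmetic is kernel-checked:

* `kernelSlopes_card`, `kernelSlopes_card_signPlus`, `kernelSlopes_card_signMinus` — there are `32` admissible exponent vectors, `16` of each sign;
* **`kernelSlope_signFlip_of_adjacent`** — THE SIGN–SLOPE PARITY LAW: if two admissible exponent vectors differ in exactly one coordinate (the kernels share
  `m = 2` slopes — the only pairs with `Ext¹ ≠ 0`), the difference there is `2` (`u′_j = −u_j`) and the SIGNS ARE OPPOSITE; stated on the sums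
  (`parity_core`) and coordinatewise;
* `kernelSlopes16_no_adjacent` — on the 16-subset `u₀ = u₁u₂` (`a₀ = a₁ + a₂`; n°22's «half of (D4)‴», signed sum `16·w_ℝ`) NO two distinct members differ
  in exactly one coordinate (no `m = 2` pair: every cross-piece Hom has degree `≥ 2`);
* `gaussianNorm_rootDiff` — `N(i^a − i^b) ∈ {2, 4}` for `a ≠ b`, `= 4` exactly when `b = a + 2` (the component counts `c ∈ {4, 16, 64}` of n°24 §2).

Nothing here says any design ∕ carrier ∕ cell ∕ stub ∕ crux statement, K-SR♭∃, VHC, `HC_AV`, `HC_CM` or HC holds. References: [cite: Markman2025SecantWeil, §1.3 and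
Thm. 1.5.1 (the Weil-type sixfolds of discriminant −1; the CM fibre)] [cite: BuchweitzFlenner2003, §5 Thm. 5.1 (semiregularity map σ)]
[cite: HuybrechtsLehn1997, §10.1.2 Lemma 10.1.3 (trace ∘ unit = rank)] [cite: Bloch1972Semiregularity, Remark (7.5)].
-/

namespace Summit.HodgeConjecture.HodgeConjecture.Ring2.SemiregularRepresentatives

set_option linter.dupNamespace false -- the cell's namespace repeats the summit name, as in every `Ring2*` file

/-! ## §1 The parity core on `ℤ∕4`: admissible sums are `{0, 2}`; a single-slope change that stays admissible is a sign flip -/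

/-- **Parity core of the sign–slope law.** If `s ∈ {0,2}` (an admissible exponent sum, sign `i^s = ±1`) and `s + δ ∈ {0,2}` with `δ ≠ 0` (one slope
changed, still admissible), then `δ = 2` (the changed slope is NEGATED, `u′_j = i²·u_j = −u_j`) and the new sum differs from the old by `2` (the SIGN FLIPS).
[cite: Markman2025SecantWeil, §1.3] -/
theorem kernelSlope_parity_core :
    ∀ s δ : ZMod 4, (s = 0 ∨ s = 2) → (s + δ = 0 ∨ s + δ = 2) → δ ≠ 0 → δ = 2 ∧ s + δ ≠ s := by
  decide

/-- The admissible sums `0` and `2` are exchanged by adding `2`: `s ∈ {0,2} → s + 2 ∈ {0,2}` and `s + 2 ≠ s` (the sign flip is an involution without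
fixed points). [cite: Markman2025SecantWeil, §1.3] -/
theorem kernelSlope_sum_add_two :
    ∀ s : ZMod 4, (s = 0 ∨ s = 2) → ((s + 2 = 0 ∨ s + 2 = 2) ∧ s + 2 ≠ s) := by
  decide

/-! ## §2 The 32 admissible slope vectors: counts and the coordinatewise parity law -/

/-- **There are exactly 32 admissible exponent vectors** `a ∈ (ℤ∕4)³` with `a₀ + a₁ + a₂ ∈ {0,2}` (the 32 roots of (D4) ∕ the 32 kernel threefolds).
[cite: Markman2025SecantWeil, Thm. 1.5.1] -/
theorem kernelSlopes_card :
    (Finset.univ.filter (fun a : ZMod 4 × ZMod 4 × ZMod 4 =>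
      a.1 + a.2.1 + a.2.2 = 0 ∨ a.1 + a.2.1 + a.2.2 = 2)).card = 32 := by
  decide

/-- `16` of them have sign `+1` (exponent sum `0`). [cite: Markman2025SecantWeil, Thm. 1.5.1] -/
theorem kernelSlopes_card_signPlus :
    (Finset.univ.filter (fun a : ZMod 4 × ZMod 4 × ZMod 4 => a.1 + a.2.1 + a.2.2 = 0)).card = 16 := by
  decide

/-- `16` of them have sign `−1` (exponent sum `2`). [cite: Markman2025SecantWeil, Thm. 1.5.1] -/
theorem kernelSlopes_card_signMinus :
    (Finset.univ.filter (fun a : ZMod 4 × ZMod 4 × ZMod 4 => a.1 + a.2.1 + a.2.2 = 2)).card = 16 := by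
  decide

/-- **THE SIGN–SLOPE PARITY LAW, coordinatewise** (n°24 §2): two admissible slope vectors that agree in two coordinates and differ in the third differ there
by `2` (`u′_j = −u_j`) and have OPPOSITE signs (exponent sums `0` and `2` in some order). Kernels sharing `m = 2` slopes — the only pairs with `Ext¹ ≠ 0`
between their structure sheaves — therefore sit in OPPOSITE shift parities in any reduced design, which is what kills the degree-1 gluing cycles in
n°24 Theorem A (b). Stated for the first coordinate; the other two follow by the symmetry of the sum (next two theorems).
[cite: BuchweitzFlenner2003, §5 Thm. 5.1] [cite: Markman2025SecantWeil, §1.3] -/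
theorem kernelSlope_signFlip_of_adjacent₀ (a₀ a₁ a₂ b₀ : ZMod 4)
    (ha : a₀ + a₁ + a₂ = 0 ∨ a₀ + a₁ + a₂ = 2) (hb : b₀ + a₁ + a₂ = 0 ∨ b₀ + a₁ + a₂ = 2) (hne : b₀ ≠ a₀) :
    b₀ = a₀ + 2 ∧ b₀ + a₁ + a₂ ≠ a₀ + a₁ + a₂ := by
  have hb' : a₀ + a₁ + a₂ + (b₀ - a₀) = 0 ∨ a₀ + a₁ + a₂ + (b₀ - a₀) = 2 := by
    have e : a₀ + a₁ + a₂ + (b₀ - a₀) = b₀ + a₁ + a₂ := by ring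
    rw [e]; exact hb
  obtain ⟨hδ, hs⟩ := kernelSlope_parity_core _ _ ha hb' (sub_ne_zero.2 hne)
  refine ⟨by linear_combination hδ, ?_⟩
  intro h
  apply hs
  linear_combination h

/-- The parity law in the second coordinate. [cite: Markman2025SecantWeil, §1.3] -/
theorem kernelSlope_signFlip_of_adjacent₁ (a₀ a₁ a₂ b₁ : ZMod 4)
    (ha : a₀ + a₁ + a₂ = 0 ∨ a₀ + a₁ + a₂ = 2) (hb : a₀ + b₁ + a₂ = 0 ∨ a₀ + b₁ + a₂ = 2) (hne : b₁ ≠ a₁) :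
    b₁ = a₁ + 2 ∧ a₀ + b₁ + a₂ ≠ a₀ + a₁ + a₂ := by
  have ha' : a₁ + a₀ + a₂ = 0 ∨ a₁ + a₀ + a₂ = 2 := by rwa [add_comm a₁ a₀]
  have hb' : b₁ + a₀ + a₂ = 0 ∨ b₁ + a₀ + a₂ = 2 := by rwa [add_comm b₁ a₀]
  obtain ⟨h1, h2⟩ := kernelSlope_signFlip_of_adjacent₀ a₁ a₀ a₂ b₁ ha' hb' hne
  exact ⟨h1, by rwa [add_comm a₀ b₁, add_comm a₀ a₁]⟩

/-- The parity law in the third coordinate. [cite: Markman2025SecantWeil, §1.3] -/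
theorem kernelSlope_signFlip_of_adjacent₂ (a₀ a₁ a₂ b₂ : ZMod 4)
    (ha : a₀ + a₁ + a₂ = 0 ∨ a₀ + a₁ + a₂ = 2) (hb : a₀ + a₁ + b₂ = 0 ∨ a₀ + a₁ + b₂ = 2) (hne : b₂ ≠ a₂) :
    b₂ = a₂ + 2 ∧ a₀ + a₁ + b₂ ≠ a₀ + a₁ + a₂ := by
  have e1 : ∀ x : ZMod 4, a₀ + a₁ + x = x + a₁ + a₀ := fun x => by ring
  rw [e1] at ha hb
  obtain ⟨h1, h2⟩ := kernelSlope_signFlip_of_adjacent₀ a₂ a₁ a₀ b₂ ha hb hne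
  exact ⟨h1, by rwa [e1 b₂, e1 a₂]⟩

/-! ## §3 The 16-subset `u₀ = u₁u₂`: no two members are adjacent -/

/-- **On the 16-subset `a₀ = a₁ + a₂` (`u₀ = u₁u₂`, n°22's half-design with signed sum `16·w_ℝ`) no two distinct members differ in exactly one coordinate**:
agreement in any two coordinates forces agreement in the third. Hence between distinct kernels of the 16-design every non-zero `Ext` has degree `≥ 2`
(`m ≤ 1`), and n°24 Theorem A (a) applies with no parity hypothesis: NO distinct-support gluing of the 16 signed kernel sheaves is σ-semiregular.
[cite: BuchweitzFlenner2003, §5 Thm. 5.1] [cite: Markman2025SecantWeil, §1.3] -/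
theorem kernelSlopes16_no_adjacent (a₀ a₁ a₂ b₀ b₁ b₂ : ZMod 4) (ha : a₀ = a₁ + a₂) (hb : b₀ = b₁ + b₂) :
    (a₁ = b₁ → a₂ = b₂ → a₀ = b₀) ∧ (a₀ = b₀ → a₂ = b₂ → a₁ = b₁) ∧ (a₀ = b₀ → a₁ = b₁ → a₂ = b₂) := by
  refine ⟨fun h1 h2 => ?_, fun h0 h2 => ?_, fun h0 h1 => ?_⟩
  · rw [ha, hb, h1, h2]
  · have : a₁ + a₂ = b₁ + b₂ := by rw [← ha, ← hb, h0]
    rw [h2] at this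
    exact add_right_cancel this
  · have : a₁ + a₂ = b₁ + b₂ := by rw [← ha, ← hb, h0]
    rw [h1] at this
    exact add_left_cancel this

/-- The 16-subset has `16` members, `8` of each sign. [cite: Markman2025SecantWeil, Thm. 1.5.1] -/
theorem kernelSlopes16_card :
    (Finset.univ.filter (fun a : ZMod 4 × ZMod 4 × ZMod 4 => a.1 = a.2.1 + a.2.2)).card = 16 ∧
    (Finset.univ.filter (fun a : ZMod 4 × ZMod 4 × ZMod 4 => a.1 = a.2.1 + a.2.2 ∧ a.1 + a.2.1 + a.2.2 = 0)).card = 8 ∧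
    (Finset.univ.filter (fun a : ZMod 4 × ZMod 4 × ZMod 4 => a.1 = a.2.1 + a.2.2 ∧ a.1 + a.2.1 + a.2.2 = 2)).card = 8 := by
  refine ⟨by decide, by decide, by decide⟩

/-- Every member of the 16-subset is admissible (`2a₁ + 2a₂ ∈ {0, 2}` in `ℤ∕4`). [cite: Markman2025SecantWeil, Thm. 1.5.1] -/
theorem kernelSlopes16_admissible (a₁ a₂ : ZMod 4) :
    (a₁ + a₂) + a₁ + a₂ = 0 ∨ (a₁ + a₂) + a₁ + a₂ = 2 := by
  revert a₁ a₂; decide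

/-! ## §4 Component counts: Gaussian norms of differences of fourth roots of unity -/

/-- **`N(i^a − i^b) ∈ {2, 4}` for `a ≠ b` in `ℤ∕4`, and `N = 4` exactly when `b = a + 2`** (`i^b = −i^a`): the number of points of `ker(u_j − u′_j) ⊂ E`,
`E = ℂ∕ℤ[i]`, whose products give the component counts `c ∈ {4, 16, 64}` of the intersections of two kernel threefolds (n°24 §2: `(m,c)`-census
`(0,16): 384`, `(0,64): 32`, `(1,4): 384`, `(1,16): 96`, `(2,4): 96`). [cite: Markman2025SecantWeil, §1.3] -/
theorem gaussianNorm_rootDiff :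
    ∀ a b : ZMod 4, a ≠ b →
      (Zsqrtd.norm ((⟨0, 1⟩ : GaussianInt) ^ a.val - (⟨0, 1⟩ : GaussianInt) ^ b.val) = 2 ∨
        Zsqrtd.norm ((⟨0, 1⟩ : GaussianInt) ^ a.val - (⟨0, 1⟩ : GaussianInt) ^ b.val) = 4) ∧
      (Zsqrtd.norm ((⟨0, 1⟩ : GaussianInt) ^ a.val - (⟨0, 1⟩ : GaussianInt) ^ b.val) = 4 ↔ b = a + 2) := by
  decide

end Summit.HodgeConjecture.HodgeConjecture.Ring2.SemiregularRepresentatives
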